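import HarnessLib
import Summits.RiemannHypothesis.RiemannHypothesis.Theorems.SignConePointwiseCheckerHSound

/-!
# Route SignCone: the Z-table evaluator for the corrected pointwise checker

Support for the unconditional rungs of `SignConeOscillatory` / `SignConeInequality`
(items stmt-RiemannHypothesis-16302 / 16301). In the corrected checker (`SignConePointwiseCheckerH.lean`)
every node of the comb and every correction term costs one evaluation of `e^{iθ}` by the interval engine.
Here all unit-circle values `Z_n ∋ e^{iu log n}`, `n ≤ N`, are built in ONE pass from a factor table:
`Z_n = Z_a · Z_b` when the certificate supplies `n = a·b` (`a, b ≥ 2`), and `e^{i u log n}` from the log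
table otherwise (primes) — so a point costs one engine exponential per prime `≤ N` plus box products.
The comb is `Σ a_n Re Z_n` and a correction term is `c (Re Z_p Re Z_q + Im Z_p Im Z_q) = c cos(u(log p − log q))`.

* `PW.zstep / ztableAux / ztable` and `PW.mem_ztable_getD`; `PW.combZ / mem_combZ`, `PW.HZ / mem_HZ`;
* `PWData.flTZ / checkGridFromZ / checkGrid₂Z / checkAGrid₂Z` (same cells, slope `slopeH`, same tail);
  soundness (`PWData.F_add_Hsos_nonneg_of_checksZ`) is in `SignConePointwiseCheckerZSound.lean`.
-/

noncomputable section

-- `Summit.RiemannHypothesis.RiemannHypothesis.…` repeats a namespace component by design (D-0017 layout).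
set_option linter.dupNamespace false

open Real

namespace Summit.RiemannHypothesis.RiemannHypothesis.Theorems.SignCone

open Literature.Analysis.ValidatedNumerics.Numerics Literature.NumberTheory.LFunctions

namespace PW

/-! ## The table of unit-circle values -/

/-- The always-sound fallback enclosure of a unit-circle value: the box `[-1, 1]²`. [folklore] -/
def unitBox : CB := ⟨⟨-(SC : ℤ), SC⟩, ⟨-(SC : ℤ), SC⟩⟩

/-- `e^{iθ} ∈ unitBox`. [folklore] -/
theorem mem_unitBox (θ : ℝ) : CB.mem (Complex.exp ((θ : ℂ) * Complex.I)) unitBox := by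
  constructor
  · rw [Complex.exp_ofReal_mul_I_re]; exact FI.mem_trivial_of_abs_le_one (Real.abs_cos_le_one θ)
  · rw [Complex.exp_ofReal_mul_I_im]; exact FI.mem_trivial_of_abs_le_one (Real.abs_sin_le_one θ)

/-- One step of the table: the value at index `n` from the entries already built (`done = [Z_0, …, Z_{n-1}]`):
a product `Z_a · Z_b` if the factor table says `n = a·b` with `a, b ≥ 2`, else the engine's `e^{iu log n}`
(or the unit box if the engine declines). [folklore] -/
def zstep (logs : List FI) (u : ℚ) (fac : List (ℕ × ℕ)) (done : List CB) (n : ℕ) : CB :=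
  if (2 ≤ (fac.getD n (0, 0)).1 ∧ 2 ≤ (fac.getD n (0, 0)).2) ∧ (fac.getD n (0, 0)).1 * (fac.getD n (0, 0)).2 = n then
    CB.mul (done.getD (fac.getD n (0, 0)).1 (CB.ofInt 0)) (done.getD (fac.getD n (0, 0)).2 (CB.ofInt 0))
  else
    match CB.expI ((FI.ofRat u).mul (logs.getD n (FI.ofInt 0))) with
    | some Zn => Zn
    | none => unitBox

/-- Build `k` further entries. [folklore] -/
def ztableAux (logs : List FI) (u : ℚ) (fac : List (ℕ × ℕ)) : ℕ → List CB → List CB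
  | 0, done => done
  | k + 1, done => ztableAux logs u fac k (done ++ [zstep logs u fac done done.length])

/-- **The Z-table** `[Z_0, Z_1, …, Z_N]`, `Z_n ∋ e^{iu log n}`. [folklore] -/
def ztable (logs : List FI) (u : ℚ) (fac : List (ℕ × ℕ)) (N : ℕ) : List CB := ztableAux logs u fac (N + 1) []

/-- The unit-circle value at a natural index. [folklore] -/
def zval (u : ℚ) (n : ℕ) : ℂ := Complex.exp ((((u : ℝ) * Real.log n : ℝ) : ℂ) * Complex.I)

/-- `zval` is multiplicative on positive naturals. [folklore] -/
theorem zval_mul (u : ℚ) {a b : ℕ} (ha : 1 ≤ a) (hb : 1 ≤ b) : zval u (a * b) = zval u a * zval u b := by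
  unfold zval
  rw [← Complex.exp_add]
  congr 1
  have ha' : (0 : ℝ) < a := by exact_mod_cast ha
  have hb' : (0 : ℝ) < b := by exact_mod_cast hb
  have e : ((u : ℝ) * Real.log ((a * b : ℕ) : ℝ) : ℝ) = (u : ℝ) * Real.log a + (u : ℝ) * Real.log b := by
    rw [Nat.cast_mul, Real.log_mul ha'.ne' hb'.ne']; ring
  rw [e, Complex.ofReal_add]
  ring

/-- **Soundness of one step**: if every entry `m < done.length`, `m ≤ N` of `done` encloses `Z_m`, then
`zstep … done n ∋ Z_n` for `n = done.length ≤ N` (`logs` the engine's log table of size `N`). [folklore] -/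
theorem mem_zstep {N : ℕ} (hok : FI.logTableOK N = true) (u : ℚ) (fac : List (ℕ × ℕ)) {done : List CB}
    (hdone : ∀ m, 1 ≤ m → m < done.length → CB.mem (zval u m) (done.getD m (CB.ofInt 0)))
    (hn : done.length ≤ N) :
    CB.mem (zval u done.length) (zstep (FI.logTable N) u fac done done.length) := by
  unfold zstep
  split_ifs with hc
  · -- product of two earlier entries
    obtain ⟨⟨ha, hb⟩, hab⟩ := hc
    set a := (fac.getD done.length (0, 0)).1
    set b := (fac.getD done.length (0, 0)).2
    have hlt_a : a < done.length := by
      rw [← hab]; nlinarith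
    have hlt_b : b < done.length := by
      rw [← hab]; nlinarith
    rw [← hab, zval_mul u (by omega) (by omega)]
    exact CB.mem_mul (hdone a (by omega) hlt_a) (hdone b (by omega) hlt_b)
  · split
    · rename_i Zn hZn
      exact CB.mem_expI hZn (FI.mem_mul (FI.mem_ofRat u) (FI.mem_logTable hok hn))
    · exact mem_unitBox _

/-- Invariant of `ztableAux`. [folklore] -/
theorem ztableAux_spec {N : ℕ} (hok : FI.logTableOK N = true) (u : ℚ) (fac : List (ℕ × ℕ)) :
    ∀ (k : ℕ) (done : List CB), done.length + k ≤ N + 1 →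
      (∀ m, 1 ≤ m → m < done.length → CB.mem (zval u m) (done.getD m (CB.ofInt 0))) →
      (ztableAux (FI.logTable N) u fac k done).length = done.length + k ∧
        ∀ m, 1 ≤ m → m < done.length + k →
          CB.mem (zval u m) ((ztableAux (FI.logTable N) u fac k done).getD m (CB.ofInt 0))
  | 0, done, _, hd => ⟨by simp [ztableAux], by simpa [ztableAux] using hd⟩
  | k + 1, done, hk, hd => by
    simp only [ztableAux]
    have hlen : (done ++ [zstep (FI.logTable N) u fac done done.length]).length = done.length + 1 := by simp
    have hd' : ∀ m, 1 ≤ m → m < (done ++ [zstep (FI.logTable N) u fac done done.length]).length →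
        CB.mem (zval u m) ((done ++ [zstep (FI.logTable N) u fac done done.length]).getD m (CB.ofInt 0)) := by
      intro m hm1 hm
      rw [hlen] at hm
      rcases Nat.lt_or_ge m done.length with h | h
      · rw [List.getD_append _ _ _ _ h]; exact hd m hm1 h
      · have he : m = done.length := by omega
        subst he
        rw [List.getD_append_right _ _ _ _ le_rfl]
        simp only [Nat.sub_self, List.getD_cons_zero]
        exact mem_zstep hok u fac hd (by omega)
    have ih := ztableAux_spec hok u fac k _ (by rw [hlen]; omega) hd'
    rw [hlen] at ih
    exact ⟨by rw [ih.1]; ring, fun m hm1 hm => ih.2 m hm1 (by omega)⟩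

/-- **Soundness of the Z-table**: `Z_n ∈ (ztable logs u fac N)[n]` for `1 ≤ n ≤ N`. [folklore] -/
theorem mem_ztable_getD {N : ℕ} (hok : FI.logTableOK N = true) (u : ℚ) (fac : List (ℕ × ℕ)) {n : ℕ}
    (hn1 : 1 ≤ n) (hn : n ≤ N) :
    CB.mem (zval u n) ((ztable (FI.logTable N) u fac N).getD n (CB.ofInt 0)) := by
  unfold ztable
  have h := ztableAux_spec hok u fac (N + 1) [] (by simp) (fun m _ hm => by simp at hm)
  exact h.2 n hn1 (by simp; omega)

/-! ## The comb and the correction from the table -/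

/-- Enclosure of `Σ_{n ∈ l} a(n) cos(u log n) = Σ a(n) Re Z_n`. [folklore] -/
def combZ (l : List ℕ) (a : ℕ → ℚ) (zt : List CB) : FI :=
  l.foldr (fun n acc => ((FI.ofRat (a n)).mul (zt.getD n (CB.ofInt 0)).re).add acc) (FI.ofInt 0)

/-- `Σ_{n ∈ l} a(n) cos(u log n) ∈ combZ l a (ztable …)` when all `1 ≤ n ≤ N`. [folklore] -/
theorem mem_combZ {N : ℕ} (hok : FI.logTableOK N = true) (u : ℚ) (fac : List (ℕ × ℕ)) (a : ℕ → ℚ) :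
    ∀ l : List ℕ, (∀ n ∈ l, 1 ≤ n ∧ n ≤ N) →
      FI.mem (l.map (fun n => (a n : ℝ) * Real.cos ((u : ℝ) * Real.log n))).sum
        (combZ l a (ztable (FI.logTable N) u fac N))
  | [], _ => by simpa [combZ] using FI.mem_ofInt 0
  | n :: t, hl => by
    have hn := hl n (by simp)
    have ih := mem_combZ hok u fac a t (fun m hm => hl m (by simp [hm]))
    rw [List.map_cons, List.sum_cons]
    show FI.mem _ (((FI.ofRat (a n)).mul ((ztable (FI.logTable N) u fac N).getD n (CB.ofInt 0)).re).add
      (combZ t a (ztable (FI.logTable N) u fac N)))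
    refine FI.mem_add (FI.mem_mul (FI.mem_ofRat (a n)) ?_) ih
    have hz := (mem_ztable_getD hok u fac hn.1 hn.2).1
    unfold zval at hz
    rwa [Complex.exp_ofReal_mul_I_re] at hz

/-- Enclosure of `H(u) = Σ_t c_t cos(u(log p_t − log q_t)) = Σ c_t (Re Z_p Re Z_q + Im Z_p Im Z_q)`. [folklore] -/
def HZ (hl : List HTerm) (zt : List CB) : FI :=
  hl.foldr (fun t acc => ((FI.ofRat t.c).mul
    ((((zt.getD t.p (CB.ofInt 0)).re).mul ((zt.getD t.q (CB.ofInt 0)).re)).add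
      (((zt.getD t.p (CB.ofInt 0)).im).mul ((zt.getD t.q (CB.ofInt 0)).im)))).add acc) (FI.ofInt 0)

/-- `H(u) ∈ HZ hl (ztable …)` when all `1 ≤ p, q ≤ N`. [folklore] -/
theorem mem_HZ {N : ℕ} (hok : FI.logTableOK N = true) (u : ℚ) (fac : List (ℕ × ℕ)) :
    ∀ hl : List HTerm, (∀ t ∈ hl, (1 ≤ t.p ∧ t.p ≤ N) ∧ (1 ≤ t.q ∧ t.q ≤ N)) →
      FI.mem (Hval hl u) (HZ hl (ztable (FI.logTable N) u fac N))
  | [], _ => by simpa [Hval, HZ] using FI.mem_ofInt 0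
  | t :: rest, hl => by
    have ht := hl t (by simp)
    have ih := mem_HZ hok u fac rest (fun s hs => hl s (by simp [hs]))
    unfold Hval at ih ⊢
    rw [List.map_cons, List.sum_cons]
    show FI.mem _ (((FI.ofRat t.c).mul
      (((((ztable (FI.logTable N) u fac N).getD t.p (CB.ofInt 0)).re).mul
          (((ztable (FI.logTable N) u fac N).getD t.q (CB.ofInt 0)).re)).add
        ((((ztable (FI.logTable N) u fac N).getD t.p (CB.ofInt 0)).im).mul
          (((ztable (FI.logTable N) u fac N).getD t.q (CB.ofInt 0)).im)))).add
      (HZ rest (ztable (FI.logTable N) u fac N)))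
    refine FI.mem_add (FI.mem_mul (FI.mem_ofRat t.c) ?_) ih
    have hp := mem_ztable_getD hok u fac ht.1.1 ht.1.2
    have hq := mem_ztable_getD hok u fac ht.2.1 ht.2.2
    unfold zval at hp hq
    rw [CB.mem] at hp hq
    rw [Complex.exp_ofReal_mul_I_re, Complex.exp_ofReal_mul_I_im] at hp hq
    have e : Real.cos ((u : ℝ) * (Real.log t.p - Real.log t.q)) =
        Real.cos ((u : ℝ) * Real.log t.p) * Real.cos ((u : ℝ) * Real.log t.q) +
          Real.sin ((u : ℝ) * Real.log t.p) * Real.sin ((u : ℝ) * Real.log t.q) := by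
      rw [mul_sub, Real.cos_sub]
    rw [e]
    exact FI.mem_add (FI.mem_mul hp.1 hq.1) (FI.mem_mul hp.2 hq.2)

end PW

/-! ## The checker with the Z-table -/

namespace PWData

section Defs

variable (D : PWData)

/-- Point bound of `F_D + H` at `u` from the Z-table (`fac` = factor table for `2 ≤ n ≤ logN`). [folklore] -/
def flTZ (cs : List (FI × FI)) (logs : List FI) (fac : List (ℕ × ℕ)) (hl : List HTerm) (w u : ℚ) : Option ℚ :=
  match CB.expI (FI.ofRat (D.d.L * u)), CB.expI (FI.ofRat (D.d.h * u)) with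
  | some Z0, some W =>
    let zt := PW.ztable logs u fac D.logN
    some (w - logPiHi + D.s + (PW.ehatFromList D.d (PW.tfiList u W cs Z0)).loQ -
      (PW.combZ D.nodeList D.a zt).hiQ + (PW.HZ hl zt).loQ)
  | _, _ => none

/-- Two-point cells for `F_D + H` with slope constant `S` (Z-table evaluation). [folklore] -/
def checkGridFromZ (cs : List (FI × FI)) (logs : List FI) (fac : List (ℕ × ℕ)) (hl : List HTerm) (S w : ℚ) :
    ℚ → ℚ → List ℚ → Bool
  | _, _, [] => true
  | u, fu, v :: rest =>
    match D.flTZ cs logs fac hl w v with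
    | some fv => decide (u ≤ v) && decide ((v - u) * S ≤ fu + fv) && checkGridFromZ cs logs fac hl S w v fv rest
    | none => false

/-- A grid passes for `F_D + H` (Z-table evaluation). [folklore] -/
def checkGrid₂Z (cs : List (FI × FI)) (logs : List FI) (fac : List (ℕ × ℕ)) (hl : List HTerm) (S w : ℚ) :
    List ℚ → Bool
  | [] => false
  | u :: rest =>
    match D.flTZ cs logs fac hl w u with
    | some fu => D.checkGridFromZ cs logs fac hl S w u fu rest
    | none => false

/-- An anchored grid passes for `F_D + H` (Z-table evaluation). [folklore] -/
def checkAGrid₂Z (cs : List (FI × FI)) (logs : List FI) (fac : List (ℕ × ℕ)) (hl : List HTerm)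
    (g : ℚ × List ℚ) : Bool :=
  match g.2 with
  | [] => false
  | u :: _ => decide (g.1 ≤ wLoQ D.prec u (D.mwAt u)) && D.checkGrid₂Z cs logs fac hl (D.slopeH logs hl) g.1 g.2

end Defs

end PWData

end Summit.RiemannHypothesis.RiemannHypothesis.Theorems.SignCone

end
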